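import Summits.CriticalPhenomena.Ising3DConformalLimit.Theorems.AnomalousForcesInteractionGaussianLimitIsFreeSphereCovariance
import Summits.CriticalPhenomena.Ising3DConformalLimit.Theorems.AnomalousForcesInteractionGaussianLimitIsFreeFarFieldExpansion
import Summits.CriticalPhenomena.Ising3DConformalLimit.Theorems.AnomalousForcesInteractionGaussianLimitIsFreeRadialShellPair
import Summits.CriticalPhenomena.Ising3DConformalLimit.Theorems.AnomalousForcesInteractionGaussianLimitIsFreeGaussMarkovRigidity
import HarnessLib

/-!
# Crux `GaussianLimitIsFree` (item stmt-CriticalPhenomena-2601), line `registered` (birth v6):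
# Gaussian Markov rigidity for the generalised free field — germ form at balls (lead c3)

THEOREM-ONLY file, part 3 (assembly) of the glue of the direct germ-form rigidity proof of stub 3
(`stub_gaussMarkovRigidity`) of `Cruxes/GaussianLimitIsFree/Lines/birth.lean`:

`stub_gaussMarkovRigidity` (the registered stub 3 of the skeleton, UNCONDITIONAL) — for `A > 0`, `1/2 ≤ Δ ≤ 1`
and a centred Gaussian probability law `μ` on `𝒮'(ℝ³)` with moment densities `(√A)ⁿ · W_Δ` (two-point function
`A‖x−y‖^{-2Δ}`) which is germ-Markov at every open ball (Kotani's Def. 1 / Rozanov's (3.14), splitting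
form `CondIndepCondExp` of the germ σ-algebras), `Δ = 1/2`.  With this file the skeleton of crux
stmt-CriticalPhenomena-2601 is closed modulo the single stub `stub_markovInheritance` (= crux
stmt-CriticalPhenomena-11236).  This is Pitt (1971) / Kotani (1973, Thm 2) / Rozanov (1982,
Ch. 3 §2.3) in the special case of the Riesz covariances, proved directly: if `Δ > 1/2`, the radial shell
pair `u₁, u₂` of `stub_radialShellPair`, `λ = U₁(e)/U₂(e)`, `w = u₁ − λu₂` (Riesz potential vanishing on
the unit sphere) has `E[ω(w)ω(v)] = 0` for all `v` outside the closed ball (part 2,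
`twoPoint_eq_zero_of_germMarkov_ball`), so the exterior potential of `w` vanishes (detectability clause),
`U₁(te) = λU₂(te)` for `t > 1`, and the second-order far field `stub_farField_expansion`
(`t^{2Δ}U_u(te) = m(u) + Δ(2Δ−1)/3 · M₂(u) t^{-2} + O(t^{-3})` for radial `u`; the coefficient vanishes
exactly at `Δ = 1/2` — Newton's shell theorem) forces `m(u₁) = λm(u₂)`, `M₂(u₁) = λM₂(u₂)`, contradicting
`M₂(u₁) ≤ m(u₁)/16`, `M₂(u₂) ≥ m(u₂)/4`.

References: L. D. Pitt, ARMA 43 (1971) 367–391; S. Kotani, LNM 330 (1973) 239–250, Thm 2; Yu. A. Rozanov,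
*Markov Random Fields* (1982), Ch. 3 §2.3 Theorem (p. 115).
-/

noncomputable section

namespace Summit.CriticalPhenomena.Ising3DConformalLimit.Cruxes.GaussianLimitIsFree.Birth

open MeasureTheory Filter Set
open scoped ProbabilityTheory Topology ENNReal
open Literature.MathematicalPhysics.QuantumLattice

section Assembly

open scoped SchwartzMap


/-- Limits bookkeeping for the far field: if `t² (F t) → L` then `F t → 0` (`t → ∞`). [folklore] -/
theorem tendsto_zero_of_tendsto_sq_mul {F : ℝ → ℝ} {L : ℝ}
    (h : Tendsto (fun t : ℝ => t ^ 2 * F t) atTop (𝓝 L)) : Tendsto F atTop (𝓝 0) := by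
  have hinv : Tendsto (fun t : ℝ => (t ^ 2)⁻¹) atTop (𝓝 0) :=
    tendsto_inv_atTop_zero.comp (tendsto_pow_atTop two_ne_zero)
  have hmul := h.mul hinv
  rw [mul_zero] at hmul
  refine hmul.congr' ?_
  filter_upwards [eventually_gt_atTop (0 : ℝ)] with t ht
  have ht2 : t ^ 2 ≠ 0 := pow_ne_zero 2 ht.ne'
  field_simp

/-- **Stub 3 of the skeleton — Gaussian Markov rigidity for the generalised free field, germ form at balls
(the registered signature `stub_gaussMarkovRigidity`, consumed by the composition `GaussianLimitIsFree_of_hyps`),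
now a THEOREM** from the tree theorems `stub_gaussian_condExp_sq_le`, `stub_sobolev_riesz_duality`,
`stub_collar_cutoff` (through `twoPoint_eq_zero_of_germMarkov_ball`), `stub_farField_expansion` and
`stub_radialShellPair`.  For `A > 0`, `1/2 ≤ Δ ≤ 1` and a centred Gaussian probability law `μ` on `𝒮'(ℝ³)`
with moment densities `(√A)ⁿ · W_Δ` which is germ-Markov at every open ball (Kotani's Def. 1 /
Rozanov's (3.14)), `Δ = 1/2`.  Proof (Pitt 1971 / Kotani 1973 / Rozanov 1982 Ch. 3 in this special
case, made explicit): if `Δ > 1/2`, take the radial shell pair `u₁, u₂` (3.5), `λ = U₁(e)/U₂(e)`,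
`w = u₁ − λu₂` (potential vanishing on the unit sphere); by `twoPoint_eq_zero_of_germMarkov_ball`
(3.1–3.3 and the splitting) `K_Δ(w, v) = 0` for all `v` outside the closed ball, so by detectability
`U₁(te) = λU₂(te)` for `t > 1`; the far field (3.4) then gives `m(u₁) = λ m(u₂)` and
`M₂(u₁) = λ M₂(u₂)` (the second-order coefficient `Δ(2Δ−1)/3` is non-zero), contradicting the moment
bounds of the two shells.  Translation invariance and reflection positivity are not used.
[cite: Rozanov1982, Ch. 3 §2.3 Theorem (p. 115)] -/
theorem stub_gaussMarkovRigidity :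
    ∀ (Δ A : ℝ)
      (μ : MeasureTheory.Measure (Literature.MathematicalPhysics.QuantumLattice.FieldConfig (EuclideanSpace ℝ (Fin 3)))),
      0 < A → 1 / 2 ≤ Δ → Δ ≤ 1 →
      MeasureTheory.IsProbabilityMeasure μ →
      Literature.MathematicalPhysics.QuantumLattice.IsGaussianField μ →
      (∀ (c : EuclideanSpace ℝ (Fin 3)) (r : ℝ), 0 < r →
        Literature.MathematicalPhysics.QuantumLattice.CondIndepCondExp
          (Literature.MathematicalPhysics.QuantumLattice.germSigma (frontier (Metric.ball c r)))
          (Literature.MathematicalPhysics.QuantumLattice.germSigma (closure (Metric.ball c r)))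
          (Literature.MathematicalPhysics.QuantumLattice.germSigma (Metric.ball c r)ᶜ) μ) →
      Literature.MathematicalPhysics.QuantumLattice.IsTranslationInvariantLaw μ →
      (∀ (n : ℕ) (c : Fin n → ℂ) (f : Fin n → SchwartzMap (EuclideanSpace ℝ (Fin 3)) ℝ), (∀ i, tsupport ⇑(f i) ⊆ {x : EuclideanSpace ℝ (Fin 3) | 0 < x 0}) → 0 ≤ (∑ i, ∑ j, (starRingEnd ℂ) (c i) * c j * Literature.MathematicalPhysics.QuantumLattice.genFunctional μ (f j - Literature.MathematicalPhysics.QuantumLattice.thetaTest 3 (f i))).re ∧ (∑ i, ∑ j, (starRingEnd ℂ) (c i) * c j * Literature.MathematicalPhysics.QuantumLattice.genFunctional μ (f j - Literature.MathematicalPhysics.QuantumLattice.thetaTest 3 (f i))).im = 0) →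
      (∀ (n : ℕ) (f : Fin n → SchwartzMap (EuclideanSpace ℝ (Fin 3)) ℝ), Literature.MathematicalPhysics.QuantumLattice.moment μ n f = ∫ x : Fin n → EuclideanSpace ℝ (Fin 3), (Real.sqrt A ^ n * Summit.CriticalPhenomena.Ising3DConformalLimit.MoebiusLimitExistsOnlyInteraction.wickPower Δ n x) * ∏ i, f i (x i)) →
      Δ = 1 / 2 := by
  intro Δ A μ hA h1 h2 hP hG hK _htr _hRP hmom
  by_contra hne
  have hΔ : 1 / 2 < Δ := lt_of_le_of_ne h1 (fun h => hne h.symm)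
  -- two-point function of the realised law
  have h2pt : ∀ u v : 𝓢((EuclideanSpace ℝ (Fin 3)), ℝ), twoPoint μ u v = A * ∫ x, ∫ y, u x * ‖x - y‖ ^ (-(2 * Δ)) * v y :=
    fun u v => twoPoint_eq_of_wickMoments hA.le (by linarith) (by linarith) hmom u v
  -- the radial shell pair
  obtain ⟨u₁, u₂, hs1, hs2, hm1, hM1, hM2, hU1e, hU2e, hint, hsph, hodd1, hodd2, hsq1, hsq2, hdet⟩ :=
    stub_radialShellPair Δ hΔ h2
  set e : (EuclideanSpace ℝ (Fin 3)) := EuclideanSpace.single (0 : Fin 3) (1 : ℝ) with he_def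
  have he : ‖e‖ = 1 := by
    rw [he_def]
    simp
  set U1e : ℝ := ∫ y, u₁ y * ‖y - e‖ ^ (-(2 * Δ)) with hU1e_def
  set U2e : ℝ := ∫ y, u₂ y * ‖y - e‖ ^ (-(2 * Δ)) with hU2e_def
  set lam : ℝ := U1e / U2e with hlam
  have hlam_pos : 0 < lam := div_pos hU1e hU2e
  set w : 𝓢((EuclideanSpace ℝ (Fin 3)), ℝ) := u₁ - lam • u₂ with hw_def
  have hw_apply : ∀ y, w y = u₁ y - lam * u₂ y := fun y => by
    simp [hw_def, smul_eq_mul]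
  have hw_supp : tsupport ⇑w ⊆ Metric.ball (0 : (EuclideanSpace ℝ (Fin 3))) 1 :=
    (tsupport_sub_smul_subset Metric.isClosed_closedBall hs1 hs2 lam).trans
      (Metric.closedBall_subset_ball (by norm_num))
  have hw_sphere : ∀ x : (EuclideanSpace ℝ (Fin 3)), ‖x‖ = 1 → ∫ y, w y * ‖y - x‖ ^ (-(2 * Δ)) = 0 := by
    intro x hx
    have hsplit : ∫ y, w y * ‖y - x‖ ^ (-(2 * Δ)) =
        (∫ y, u₁ y * ‖y - x‖ ^ (-(2 * Δ))) - lam * ∫ y, u₂ y * ‖y - x‖ ^ (-(2 * Δ)) := by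
      rw [← integral_const_mul, ← integral_sub (hint x).1 ((hint x).2.const_mul lam)]
      refine integral_congr_ae (Eventually.of_forall fun y => ?_)
      simp only [hw_apply]
      ring
    rw [hsplit, (hsph x hx).1, (hsph x hx).2]
    have hU2ne : U2e ≠ 0 := hU2e.ne'
    simp only [hlam]
    field_simp
    ring
  -- vanishing of the covariance across the sphere, hence of the exterior potential of `w`
  haveI := hP
  have hzero : ∀ v : 𝓢((EuclideanSpace ℝ (Fin 3)), ℝ), tsupport ⇑v ⊆ (Metric.closedBall (0 : (EuclideanSpace ℝ (Fin 3))) 1)ᶜ →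
      ∫ x, ∫ y, w x * ‖x - y‖ ^ (-(2 * Δ)) * v y = 0 := by
    intro v hv
    have h0 := twoPoint_eq_zero_of_germMarkov_ball hΔ h2 hA hG h2pt (hK 0 1 one_pos)
      hw_supp hw_sphere hv
    rw [h2pt] at h0
    rcases mul_eq_zero.1 h0 with hA0 | hI
    · exact absurd hA0 hA.ne'
    · exact hI
  have hext : ∀ t₀ : ℝ, 1 < t₀ →
      (∫ y, u₁ y * ‖y - t₀ • e‖ ^ (-(2 * Δ))) - lam * ∫ y, u₂ y * ‖y - t₀ • e‖ ^ (-(2 * Δ)) = 0 := by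
    intro t₀ ht₀
    by_contra hne'
    obtain ⟨v, hv, hvK⟩ := hdet lam t₀ ht₀ hne'
    exact hvK (hzero v hv)
  -- far field of `u₁` and `u₂`
  set P1 : ℝ → ℝ := fun t => ∫ y, u₁ y * ‖y - t • e‖ ^ (-(2 * Δ)) with hP1
  set P2 : ℝ → ℝ := fun t => ∫ y, u₂ y * ‖y - t • e‖ ^ (-(2 * Δ)) with hP2
  set m₁ : ℝ := ∫ y, u₁ y with hm₁
  set m₂ : ℝ := ∫ y, u₂ y with hm₂
  set M₁ : ℝ := ∫ y, u₁ y * ‖y‖ ^ 2 with hM₁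
  set M₂ : ℝ := ∫ y, u₂ y * ‖y‖ ^ 2 with hM₂
  have hs1' : tsupport ⇑u₁ ⊆ Metric.closedBall (0 : (EuclideanSpace ℝ (Fin 3))) 1 :=
    hs1.trans (Metric.closedBall_subset_closedBall (by norm_num))
  have hs2' : tsupport ⇑u₂ ⊆ Metric.closedBall (0 : (EuclideanSpace ℝ (Fin 3))) 1 :=
    hs2.trans (Metric.closedBall_subset_closedBall (by norm_num))
  have T1 : Tendsto (fun t : ℝ => t ^ 2 * (t ^ (2 * Δ) * P1 t - m₁)) atTop
      (𝓝 ((Δ * (2 * Δ - 1) / 3) * M₁)) := by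
    have h := stub_farField_expansion Δ (by linarith) u₁ hs1' e he
    rw [hodd1, hsq1] at h
    have hlim : 2 * Δ * (Δ + 1) * ((1 / 3) * M₁) - Δ * M₁ = (Δ * (2 * Δ - 1) / 3) * M₁ := by ring
    rw [hlim] at h
    refine h.congr' (Eventually.of_forall fun t => ?_)
    simp only [hP1, hm₁, mul_zero, sub_zero]
  have T2 : Tendsto (fun t : ℝ => t ^ 2 * (t ^ (2 * Δ) * P2 t - m₂)) atTop
      (𝓝 ((Δ * (2 * Δ - 1) / 3) * M₂)) := by
    have h := stub_farField_expansion Δ (by linarith) u₂ hs2' e he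
    rw [hodd2, hsq2] at h
    have hlim : 2 * Δ * (Δ + 1) * ((1 / 3) * M₂) - Δ * M₂ = (Δ * (2 * Δ - 1) / 3) * M₂ := by ring
    rw [hlim] at h
    refine h.congr' (Eventually.of_forall fun t => ?_)
    simp only [hP2, hm₂, mul_zero, sub_zero]
  -- first order: `m₁ = lam m₂`
  have F1 : Tendsto (fun t : ℝ => t ^ (2 * Δ) * P1 t - m₁) atTop (𝓝 0) := tendsto_zero_of_tendsto_sq_mul T1
  have F2 : Tendsto (fun t : ℝ => t ^ (2 * Δ) * P2 t - m₂) atTop (𝓝 0) := tendsto_zero_of_tendsto_sq_mul T2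
  have hPrel : ∀ᶠ t : ℝ in atTop, P1 t = lam * P2 t := by
    filter_upwards [eventually_gt_atTop (1 : ℝ)] with t ht
    have := hext t ht
    simp only [hP1, hP2]
    linarith
  have hm_rel : m₁ - lam * m₂ = 0 := by
    -- the function `(t^{2Δ} P1 t - m₁) - lam (t^{2Δ} P2 t - m₂)` is eventually the constant `-(m₁ - lam m₂)`
    have hc : Tendsto (fun t : ℝ => (t ^ (2 * Δ) * P1 t - m₁) - lam * (t ^ (2 * Δ) * P2 t - m₂)) atTop
        (𝓝 (0 - lam * 0)) := F1.sub (F2.const_mul lam)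
    rw [mul_zero, sub_zero] at hc
    have hc' : Tendsto (fun _ : ℝ => -(m₁ - lam * m₂)) atTop (𝓝 0) := by
      refine hc.congr' ?_
      filter_upwards [hPrel] with t ht
      rw [ht]
      ring
    have := tendsto_nhds_unique hc' tendsto_const_nhds
    linarith
  -- second order: `M₁ = lam M₂`
  have hM_rel : (Δ * (2 * Δ - 1) / 3) * (M₁ - lam * M₂) = 0 := by
    have hc : Tendsto (fun t : ℝ => t ^ 2 * (t ^ (2 * Δ) * P1 t - m₁) - lam * (t ^ 2 * (t ^ (2 * Δ) * P2 t - m₂)))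
        atTop (𝓝 ((Δ * (2 * Δ - 1) / 3) * M₁ - lam * ((Δ * (2 * Δ - 1) / 3) * M₂))) :=
      T1.sub (T2.const_mul lam)
    have hc' : Tendsto (fun _ : ℝ => (0 : ℝ)) atTop
        (𝓝 ((Δ * (2 * Δ - 1) / 3) * M₁ - lam * ((Δ * (2 * Δ - 1) / 3) * M₂))) := by
      refine hc.congr' ?_
      filter_upwards [hPrel] with t ht
      rw [ht]
      have : m₁ = lam * m₂ := by linarith
      rw [this]
      ring
    have := tendsto_nhds_unique hc' tendsto_const_nhds
    linarith
  have hcoef : (Δ * (2 * Δ - 1) / 3) ≠ 0 := by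
    have : 0 < Δ * (2 * Δ - 1) / 3 := by
      have h2Δ : 0 < 2 * Δ - 1 := by linarith
      positivity
    exact this.ne'
  have hM_rel' : M₁ = lam * M₂ := by
    have := (mul_eq_zero.1 hM_rel).resolve_left hcoef
    linarith
  -- arithmetic contradiction with the moment bounds of the two shells
  have hm₂pos : 0 < m₂ := by
    have : m₁ = lam * m₂ := by linarith
    by_contra hle
    push Not at hle
    have : m₁ ≤ 0 := by
      rw [this]
      exact mul_nonpos_of_nonneg_of_nonpos hlam_pos.le hle
    linarith
  have hlow : lam * ((1 / 4) * m₂) ≤ lam * M₂ := mul_le_mul_of_nonneg_left hM2 hlam_pos.le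
  have hm1eq : m₁ = lam * m₂ := by linarith
  nlinarith [hM1, hlow, hM_rel', hm1eq, hm1, hlam_pos]

end Assembly

end Summit.CriticalPhenomena.Ising3DConformalLimit.Cruxes.GaussianLimitIsFree.Birth

end
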